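import Literature.Probability.Percolation.CoveringMonotonicity
import Literature.Probability.Percolation.BondTriangularUpperBound
import Literature.Probability.Percolation.SubgraphMonotonicity
import HarnessLib

/-!
# `p_c^bond(ℤ³) ≤ p_c^bond(𝕋) ≤ 2 sin(π/18)` (Gomes–Pereira–Sanchis 2026, Theorem 1 at `d = 3`)

Topic `Literature/Probability/Percolation`; theorems only (no new facts, no `sorry`).

P. A. Gomes, A. Pereira, R. Sanchis, *Upper bounds for critical probabilities in Bernoulli
percolation models*, J. Appl. Probab. **63** (2026) 61–72 (= arXiv:2106.10388), Proposition 2: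
"Let `(p₁,p₂,p₃) ∈ [0,1]` and consider two inhomogeneous bond Bernoulli percolation processes on
the triangular lattice and on `ℤ³`, both with parameters `(p₁,p₂,p₃)`. Then
`θ^b_𝕋(p₁,p₂,p₃) ≤ θ^b_3(p₁,p₂,p₃)`" (a dynamical susceptible–infected coupling: a step `u = ±(1,0),
±(0,1), ±(1,1)` of `𝕋` is lifted to the step `τ(u) = ±e₁, ±e₂, ±e₃` of `ℤ³`), whence their
Theorem 1 at `d = 3`: `p_c^b(3) ≤ p*(3)`, `p*(3)` the root in `(0,1)` of `p³ = 3p − 1`, i.e.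
`p*(3) = 2 sin(π/18) = p_c^b(𝕋)` (§5, table: `p_c^b(3) ≤ 0.3473`).

Here the homogeneous case is obtained from two theorems already PROVED in the tree:

* the lift `(a,b,c) ↦ (a + c, b − c)` is a weak covering map `ℤ³ → 𝕋` onto the tree's `triGraph`
  (diagonal `(1,−1)`; `CubicTri.surjOn_neighborSet_proj`), so by the tree's proof of Lyons–Peres
  Theorem 6.47 (Campanino 1985 / Benjamini–Schramm 1996; `LyonsPeres647.theta_le_of_surjOn_neighborSet`,
  an exploration coupling of exactly the Gomes–Pereira–Sanchis kind) `θ_𝕋(0,p) ≤ θ_{ℤ³}(0,p)` for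
  every `p` (`CubicTri.theta_triGraph_le_theta_cubic`) and `p_c(ℤ³) ≤ p_c(𝕋)`
  (`CubicTri.criticalProb_cubic_le_triGraph`, via `criticalProb_le_of_theta_le`);
* the tree's proof of the upper-bound half of Wierman's theorem, `p_c(𝕋) ≤ 2 sin(π/18)`
  (`BondTri.criticalProb_triGraph_le`, Grimmett 1999 Thm (11.116)), gives
  `CubicTri.criticalProb_cubic_le_two_mul_sin : p_c^bond(ℤ³) ≤ 2 sin(π/18)` and the decimal
  corollary `CubicTri.criticalProb_cubic_lt : p_c^bond(ℤ³) < 7/20` (`sin x < x`, `π < 3.15`).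

This sharpens the tree's `kesten_criticalProb_Z3_lt_half_holds` (`p_c(ℤ³) ≤ 24/49 < 1/2`, van den
Berg–Frieze ladders) from `0.4898` to `0.3473`.

## References

* P. A. Gomes, A. Pereira, R. Sanchis, J. Appl. Probab. 63 (2026) 61–72, Proposition 2, Theorem 1,
  §5 [GomesPereiraSanchis2026].
* R. Lyons, Y. Peres, *Probability on Trees and Networks* (2016), Thm. 6.47 [LyonsPeres2016].
* G. Grimmett, *Percolation*, 2nd ed. (1999), §11.9 Thm (11.116) [GrimmettPercolation1999].
-/

noncomputable section

namespace Literature.Probability.Percolation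

open LatticeModels

namespace CubicTri

/-- The projection `ℤ³ → ℤ²`, `(a, b, c) ↦ (a + c, b − c)`: the covering map of the cubic lattice
onto the triangular lattice `triGraph` (Gomes–Pereira–Sanchis: `τ(±(1,0)) = ±e₁`, `τ(±(0,1)) = ±e₂`,
`τ(±diagonal) = ±e₃`; the tree's diagonal is `(1,−1)`).
[cite: GomesPereiraSanchis2026, Proposition 2 (the map τ)] -/
def proj (x : Site 3) : Site 2 := ![x 0 + x 2, x 1 - x 2]

/-- First coordinate of the projection. [folklore] -/
@[simp] theorem proj_apply_zero (x : Site 3) : proj x 0 = x 0 + x 2 := rfl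

/-- Second coordinate of the projection. [folklore] -/
@[simp] theorem proj_apply_one (x : Site 3) : proj x 1 = x 1 - x 2 := rfl

/-- The projection fixes the origin. [folklore] -/
theorem proj_zero : proj 0 = 0 := by
  ext i; fin_cases i <;> simp

/-- The projection is additive. [folklore] -/
theorem proj_add (x y : Site 3) : proj (x + y) = proj x + proj y := by
  ext i; fin_cases i <;> simp <;> ring

/-- The projection respects subtraction. [folklore] -/
theorem proj_sub (x y : Site 3) : proj (x - y) = proj x - proj y := by
  ext i; fin_cases i <;> simp <;> ring

/-- `e₁ ↦ (1, 0)`. [folklore] -/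
theorem proj_single_zero : proj (Pi.single 0 1) = Pi.single 0 1 := by
  ext i; fin_cases i <;> simp [proj]

/-- `e₂ ↦ (0, 1)`. [folklore] -/
theorem proj_single_one : proj (Pi.single 1 1) = Pi.single 1 1 := by
  ext i; fin_cases i <;> simp [proj]

/-- `e₃ ↦ (1, −1)`, the diagonal of `triGraph`. [folklore] -/
theorem proj_single_two : proj (Pi.single 2 1) = triDiag := by
  ext i; fin_cases i <;> simp [proj, triDiag]

/-- **The projection is a weak covering map `ℤ³ → 𝕋`**: it maps the six neighbours of `x` onto
the six neighbours of `proj x` in `triGraph`.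
[cite: GomesPereiraSanchis2026, Proposition 2 (proof: the susceptible–infected coupling)] -/
theorem surjOn_neighborSet_proj (x : Site 3) :
    Set.SurjOn proj ((zdGraph 3).neighborSet x) (triGraph.neighborSet (proj x)) := by
  intro y' hy'
  rw [SimpleGraph.mem_neighborSet, triGraph_adj_iff] at hy'
  rcases hy' with h2 | h2 | h2
  · obtain ⟨i, hi | hi⟩ := (zdGraph_adj_iff _ _).1 h2
    · fin_cases i
      · exact ⟨x + Pi.single 0 1, (SimpleGraph.mem_neighborSet _ _ _).2 ((zdGraph_adj_iff _ _).2 ⟨0, Or.inl rfl⟩),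
          by rw [proj_add, proj_single_zero]; exact hi.symm⟩
      · exact ⟨x + Pi.single 1 1, (SimpleGraph.mem_neighborSet _ _ _).2 ((zdGraph_adj_iff _ _).2 ⟨1, Or.inl rfl⟩),
          by rw [proj_add, proj_single_one]; exact hi.symm⟩
    · fin_cases i
      · exact ⟨x - Pi.single 0 1, (SimpleGraph.mem_neighborSet _ _ _).2 ((zdGraph_adj_iff _ _).2 ⟨0, Or.inr (sub_add_cancel _ _).symm⟩),
          by rw [proj_sub, proj_single_zero]; exact (eq_sub_of_add_eq hi.symm).symm⟩
      · exact ⟨x - Pi.single 1 1, (SimpleGraph.mem_neighborSet _ _ _).2 ((zdGraph_adj_iff _ _).2 ⟨1, Or.inr (sub_add_cancel _ _).symm⟩),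
          by rw [proj_sub, proj_single_one]; exact (eq_sub_of_add_eq hi.symm).symm⟩
  · exact ⟨x + Pi.single 2 1, (SimpleGraph.mem_neighborSet _ _ _).2 ((zdGraph_adj_iff _ _).2 ⟨2, Or.inl rfl⟩),
      by rw [proj_add, proj_single_two]; exact h2.symm⟩
  · exact ⟨x - Pi.single 2 1, (SimpleGraph.mem_neighborSet _ _ _).2 ((zdGraph_adj_iff _ _).2 ⟨2, Or.inr (sub_add_cancel _ _).symm⟩),
      by rw [proj_sub, proj_single_two]; exact (eq_sub_of_add_eq h2.symm).symm⟩

/-- **`θ_𝕋(0, p) ≤ θ_{ℤ³}(0, p)` for every `p`** (Gomes–Pereira–Sanchis 2026, Proposition 2,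
homogeneous case), by the tree's covering theorem (Lyons–Peres Thm. 6.47) applied to `proj`.
[cite: GomesPereiraSanchis2026, Proposition 2] -/
theorem theta_triGraph_le_theta_cubic (p : unitInterval) :
    theta triGraph (0 : Site 2) p ≤ theta (zdGraph 3) (0 : Site 3) p := by
  have h := LyonsPeres647.theta_le_of_surjOn_neighborSet (zdGraph 3) triGraph proj
    surjOn_neighborSet_proj 0 p
  rwa [proj_zero] at h

/-- **`p_c^bond(ℤ³) ≤ p_c^bond(𝕋)`** (Gomes–Pereira–Sanchis 2026, Theorem 1 at `d = 3`, in the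
form "`ℤ³` percolates whenever `𝕋` does"). [cite: GomesPereiraSanchis2026, Theorem 1 (d = 3)] -/
theorem criticalProb_cubic_le_triGraph :
    criticalProb (zdGraph 3) (0 : Site 3) ≤ criticalProb triGraph (0 : Site 2) :=
  criticalProb_le_of_theta_le (zdGraph 3) 0 triGraph 0 theta_triGraph_le_theta_cubic

/-- **`p_c^bond(ℤ³) ≤ 2 sin(π/18) = 0.3472…`** (Gomes–Pereira–Sanchis 2026, Theorem 1 at `d = 3`
and §5: `p_c^b(3) ≤ 0.3473`), from `criticalProb_cubic_le_triGraph` and the tree's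
`BondTri.criticalProb_triGraph_le` (`p_c(𝕋) ≤ 2 sin(π/18)`, Grimmett 1999 Thm (11.116)).
[cite: GomesPereiraSanchis2026, Theorem 1 (d = 3) and §5] -/
theorem criticalProb_cubic_le_two_mul_sin :
    criticalProb (zdGraph 3) (0 : Site 3) ≤ 2 * Real.sin (Real.pi / 18) :=
  criticalProb_cubic_le_triGraph.trans (BondTri.criticalProb_triGraph_le 0)

/-- `2 sin(π/18) < 7/20` (`sin x < x` for `x > 0` and `π < 3.15`). [folklore] -/
theorem two_mul_sin_pi_div_eighteen_lt : 2 * Real.sin (Real.pi / 18) < 7 / 20 := by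
  have h1 : Real.sin (Real.pi / 18) < Real.pi / 18 := Real.sin_lt (by positivity)
  have h2 : Real.pi < 3.15 := Real.pi_lt_d2
  linarith

/-- **`p_c^bond(ℤ³) < 7/20`**, a decimal form of `p_c^bond(ℤ³) ≤ 2 sin(π/18)`.
[cite: GomesPereiraSanchis2026, §5 (table: p_c^b(3) ≤ 0.3473)] -/
theorem criticalProb_cubic_lt : criticalProb (zdGraph 3) (0 : Site 3) < 7 / 20 :=
  criticalProb_cubic_le_two_mul_sin.trans_lt two_mul_sin_pi_div_eighteen_lt

end CubicTri

end Literature.Probability.Percolation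

end
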